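import Mathlib
import Summits.QuantumAdvantage.QuantumAdvantage.Theorems.LinnikCubicClassGroupsPureCubicClassNumberHardGenusSetup

/-!
# Crux `LinnikCubicClassGroups.PureCubicClassNumberHard` (stmt-QuantumAdvantage-11826) —
# genus theory for `N = ℚ(ζ₃, ∛(pq)) / ℚ(ζ₃)`, part 3: ideals — ramification `3` at the inert primes, counts of `ℚ(ζ)`-elements, supports

Line `Sketch` (honda-leak arm), towards / including the lead's stub `stub_ambiguousTrivial`
(`3 ∤ h_N`).  Setting of part 1 (`…GenusSetup`): a Galois number field `N` of degree `6`,
`ζ² + ζ + 1 = 0`, `σ ≠ 1` fixing `ζ`, `F = ℚ(ζ)`, `Gal(N/F) = ⟨σ⟩`.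

* `genus_ramificationIdx_int`, `genus_ramificationIdx_rel` — `(p) = P³` gives `e(P|p) = 3` over `ℤ`
  and `e(P|𝔭) = 3` over `ℚ(ζ)` (the quadratic field has `e(𝔭|p) ≤ 2`);
* `genus_three_dvd_multiplicity_map`, `genus_three_dvd_count_adjoin` — ideals and elements of
  `ℚ(ζ)` have `P`-multiplicity `≡ 0 (mod 3)`;
* `genus_eq_of_count_eq`, `genus_eq_zpow_mul_zpow`, `genus_coe_zpow_three`,
  `genus_count_natCast_zpow`, `genus_spanSingleton_zpow`, `genus_isPrincipal_of_coe_eq` —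
  factorisation bookkeeping for fractional ideals;
* `genus_spanSingleton_stable`, `genus_coeIdeal_stable` — `⟨σ⟩`-stability of `(x)` with
  `σx ∈ 𝓞_N x` and of `𝔟` with `σ̂𝔟 ⊆ 𝔟`.
-/

set_option linter.dupNamespace false -- D-0017 (Summits/<S>/<S>/… by design)

namespace Summit.QuantumAdvantage.QuantumAdvantage.Theorems.LinnikCubicClassGroups

open NumberField IsDedekindDomain
open scoped IntermediateField nonZeroDivisors

variable {N : Type} [Field N] [NumberField N]

variable [IsGalois ℚ N]

/-! ## Part 3: ideals — counts at the totally ramified primes -/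

section Ideals

omit [IsGalois ℚ N] in
/-- The count of an integral ideal at `v` is the multiplicity of `v` in it. [folklore] -/
theorem genus_count_coe {J : Ideal (𝓞 N)} (hJ : J ≠ ⊥) (v : HeightOneSpectrum (𝓞 N)) :
    FractionalIdeal.count N v (J : FractionalIdeal (𝓞 N)⁰ N) = multiplicity v.asIdeal J := by
  classical
  rw [FractionalIdeal.count_coe N v hJ, Ideal.count_associates_factors_eq hJ v.isPrime v.ne_bot,
    IsDedekindDomain.HeightOneSpectrum.count_normalizedFactors_eq_multiplicity hJ]

omit [IsGalois ℚ N] in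
/-- Multiplicity of a prime in a power of itself times a coprime ideal. [folklore] -/
theorem genus_multiplicity_prime_pow_mul (v : HeightOneSpectrum (𝓞 N)) {J : Ideal (𝓞 N)}
    (hJ : J ≠ ⊥) (m : ℕ) : multiplicity v.asIdeal (v.asIdeal ^ m * J) = m + multiplicity v.asIdeal J := by
  have hprime : Prime v.asIdeal := Ideal.prime_of_isPrime v.ne_bot v.isPrime
  have hne : v.asIdeal ^ m * J ≠ 0 := mul_ne_zero (pow_ne_zero _ v.ne_bot) hJ
  rw [multiplicity_mul hprime (FiniteMultiplicity.of_prime_left hprime hne),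
    multiplicity_pow_self v.ne_bot (fun h => v.isPrime.ne_top (Ideal.isUnit_iff.mp h)) m]

omit [IsGalois ℚ N] in
/-- **`e(P | p) = 3`** over `ℤ` when `(p) = P³`. [folklore] -/
theorem genus_ramificationIdx_int {p : ℕ} (hp : p.Prime) (P : HeightOneSpectrum (𝓞 N))
    (hspan : Ideal.span {(p : 𝓞 N)} = P.asIdeal ^ 3) : P.asIdeal.ramificationIdx ℤ = 3 := by
  haveI := P.isPrime
  have hpP : (p : 𝓞 N) ∈ P.asIdeal := by
    have : (p : 𝓞 N) ∈ P.asIdeal ^ 3 := hspan ▸ Ideal.mem_span_singleton_self _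
    exact Ideal.pow_le_self (by norm_num) this
  have hunder : P.asIdeal.under ℤ = Ideal.span {(p : ℤ)} := by
    haveI := P.isMaximal
    haveI hmax : (Ideal.span {(p : ℤ)}).IsMaximal :=
      Ideal.IsPrime.isMaximal
        ((Ideal.span_singleton_prime (by exact_mod_cast hp.ne_zero)).mpr
          (Nat.prime_iff_prime_int.mp hp)) (by simpa using hp.ne_zero)
    refine (hmax.eq_of_le (Ideal.IsMaximal.under ℤ P.asIdeal).ne_top ?_).symm
    rw [Ideal.span_singleton_le_iff_mem, Ideal.under_def, Ideal.mem_comap, map_natCast]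
    exact hpP
  haveI : P.asIdeal.LiesOver (Ideal.span {(p : ℤ)}) := ⟨hunder.symm⟩
  have hmap : (Ideal.span {(p : ℤ)}).map (algebraMap ℤ (𝓞 N)) = P.asIdeal ^ 3 := by
    rw [Ideal.map_span, Set.image_singleton, map_natCast, hspan]
  rw [Ideal.IsDedekindDomain.ramificationIdx_eq_multiplicity (Ideal.span {(p : ℤ)}) P.asIdeal
    (by rw [hmap]; exact pow_ne_zero _ P.ne_bot), hmap,
    multiplicity_pow_self P.ne_bot (fun h => P.isPrime.ne_top (Ideal.isUnit_iff.mp h))]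

omit [IsGalois ℚ N] in
/-- **`e(P | 𝔭) = 3`** over `ℚ(ζ)` when `(p) = P³` (the quadratic field `ℚ(ζ)` has `e(𝔭 | p) ≤ 2`,
and `e(P | p) = e(𝔭 | p) · e(P | 𝔭) = 3`). [folklore] -/
theorem genus_ramificationIdx_rel {ζ : N} (hζ : IsPrimitiveRoot ζ 3) {p : ℕ} (hp : p.Prime)
    (P : HeightOneSpectrum (𝓞 N)) (hspan : Ideal.span {(p : 𝓞 N)} = P.asIdeal ^ 3) :
    P.asIdeal.ramificationIdx (𝓞 ℚ⟮ζ⟯) = 3 := by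
  haveI := P.isMaximal
  set F : IntermediateField ℚ N := ℚ⟮ζ⟯ with hF
  set 𝔭 : Ideal (𝓞 F) := P.asIdeal.under (𝓞 F) with h𝔭
  haveI : 𝔭.IsMaximal := Ideal.IsMaximal.under _ _
  have h3 := genus_ramificationIdx_int hp P hspan
  have htower : P.asIdeal.ramificationIdx ℤ = 𝔭.ramificationIdx ℤ * P.asIdeal.ramificationIdx (𝓞 F) :=
    Ideal.ramificationIdx_tower (R := ℤ) 𝔭 P.asIdeal
  rw [h3] at htower
  -- `e(𝔭 | p) ≤ [F : ℚ] = 2`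
  have h𝔭0 : 𝔭.under ℤ ≠ ⊥ := by
    haveI : (𝔭.under ℤ).IsMaximal := Ideal.IsMaximal.under _ _
    exact Ideal.IsMaximal.ne_bot_of_isIntegral_int _  -- hmm, for ideals of ℤ? fixed below if needed
  have hle : 𝔭.ramificationIdx ℤ ≤ 2 := by
    haveI : (𝔭.under ℤ).IsMaximal := Ideal.IsMaximal.under _ _
    have h := Ideal.ramificationIdx_le_finrank (S := 𝓞 F) ℚ F 𝔭 (p := 𝔭.under ℤ)
    rw [Ideal.ramificationIdx'_eq_ramificationIdx (𝔭.under ℤ) 𝔭 h𝔭0, genus_finrank_adjoin hζ] at h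
    exact h
  have hpos : 0 < P.asIdeal.ramificationIdx (𝓞 F) := Ideal.ramificationIdx_pos _ _
  have hpos' : 0 < 𝔭.ramificationIdx ℤ := Ideal.ramificationIdx_pos _ _
  -- `3 = a · b`, `a ≤ 2` forces `b = 3`
  rcases Nat.eq_or_lt_of_le hle with h2 | h2
  · rw [h2] at htower; omega
  · interval_cases h : 𝔭.ramificationIdx ℤ
    omega

omit [IsGalois ℚ N] in
/-- **Ideals extended from `ℚ(ζ)` have multiplicity `≡ 0 (mod 3)` at `P`** (`(p) = P³`): for a
nonzero ideal `𝔞` of `𝓞 ℚ(ζ)`, `3 ∣ mult_P(𝔞 𝓞_N)` — write `𝔞 = 𝔭^m 𝔟` with `𝔭 = P ∩ ℚ(ζ)`,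
`𝔭 ∤ 𝔟`; then `mult_P(𝔞𝓞_N) = m · e(P|𝔭) + 0 = 3m`. [folklore] -/
theorem genus_three_dvd_multiplicity_map {ζ : N} (hζ : IsPrimitiveRoot ζ 3) {p : ℕ} (hp : p.Prime)
    (P : HeightOneSpectrum (𝓞 N)) (hspan : Ideal.span {(p : 𝓞 N)} = P.asIdeal ^ 3)
    {𝔞 : Ideal (𝓞 ℚ⟮ζ⟯)} (h𝔞 : 𝔞 ≠ ⊥) :
    3 ∣ multiplicity P.asIdeal (𝔞.map (algebraMap (𝓞 ℚ⟮ζ⟯) (𝓞 N))) := by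
  haveI := P.isMaximal
  set 𝔭 : Ideal (𝓞 ℚ⟮ζ⟯) := P.asIdeal.under (𝓞 ℚ⟮ζ⟯) with h𝔭
  haveI h𝔭max : 𝔭.IsMaximal := Ideal.IsMaximal.under _ _
  have h𝔭0 : 𝔭 ≠ ⊥ := Ideal.IsMaximal.ne_bot_of_isIntegral_int _
  have h𝔭prime : Prime 𝔭 := Ideal.prime_of_isPrime h𝔭0 h𝔭max.isPrime
  have hPprime : Prime P.asIdeal := Ideal.prime_of_isPrime P.ne_bot P.isPrime
  set f := algebraMap (𝓞 ℚ⟮ζ⟯) (𝓞 N) with hf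
  -- `𝔞 = 𝔭^m * 𝔟`, `𝔭 ∤ 𝔟`
  set m := multiplicity 𝔭 𝔞 with hm
  have hfin : FiniteMultiplicity 𝔭 𝔞 := FiniteMultiplicity.of_prime_left h𝔭prime h𝔞
  obtain ⟨𝔟, h𝔞eq⟩ : 𝔭 ^ m ∣ 𝔞 := hfin.pow_dvd_iff_le_multiplicity.mpr le_rfl
  have h𝔟 : ¬ 𝔭 ∣ 𝔟 := by
    intro hdvd
    have : 𝔭 ^ (m + 1) ∣ 𝔞 := by
      rw [h𝔞eq, pow_succ]; exact mul_dvd_mul_left _ hdvd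
    have := hfin.pow_dvd_iff_le_multiplicity.mp this
    omega
  -- extend to `N`
  have hmap : 𝔞.map f = (𝔭.map f) ^ m * 𝔟.map f := by
    rw [h𝔞eq, Ideal.map_mul, Ideal.map_pow]
  have hmap0 : 𝔞.map f ≠ ⊥ := Ideal.map_ne_bot_of_ne_bot h𝔞
  have h𝔭map0 : 𝔭.map f ≠ ⊥ := Ideal.map_ne_bot_of_ne_bot h𝔭0
  have e𝔭 : emultiplicity P.asIdeal (𝔭.map f) = 3 := by
    rw [(FiniteMultiplicity.of_prime_left hPprime h𝔭map0).emultiplicity_eq_multiplicity,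
      ← Ideal.IsDedekindDomain.ramificationIdx_eq_multiplicity 𝔭 P.asIdeal h𝔭map0,
      genus_ramificationIdx_rel hζ hp P hspan]
    rfl
  have e𝔟 : emultiplicity P.asIdeal (𝔟.map f) = 0 := by
    rw [emultiplicity_eq_zero]
    intro hdvd
    apply h𝔟
    rw [Ideal.dvd_iff_le] at hdvd ⊢
    have := Ideal.le_comap_of_map_le hdvd
    exact this
  have etot : emultiplicity P.asIdeal (𝔞.map f) = (3 * m : ℕ) := by
    rw [hmap, emultiplicity_mul hPprime, emultiplicity_pow hPprime, e𝔭, e𝔟, add_zero]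
    norm_cast
    ring_nf
  rw [multiplicity_eq_of_emultiplicity_eq_some etot]
  exact Dvd.intro m rfl

omit [IsGalois ℚ N] in
/-- Count at `v` of the principal fractional ideal of an algebraic integer. [folklore] -/
theorem genus_count_spanSingleton_coe (v : HeightOneSpectrum (𝓞 N)) {r : 𝓞 N} (hr : r ≠ 0) :
    FractionalIdeal.count N v (FractionalIdeal.spanSingleton (𝓞 N)⁰ (r : N)) =
      multiplicity v.asIdeal (Ideal.span {r}) := by
  rw [← genus_count_coe (by rwa [Ne, Ideal.span_singleton_eq_bot]) v,
    FractionalIdeal.coeIdeal_span_singleton]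

omit [IsGalois ℚ N] in
/-- **Elements of `ℚ(ζ)` have count `≡ 0 (mod 3)` at `P`** (`(p) = P³`): for `c ∈ ℚ(ζ)ˣ`,
`3 ∣ v_P((c))`. [folklore] -/
theorem genus_three_dvd_count_adjoin {ζ : N} (hζ : IsPrimitiveRoot ζ 3) {p : ℕ} (hp : p.Prime)
    (P : HeightOneSpectrum (𝓞 N)) (hspan : Ideal.span {(p : 𝓞 N)} = P.asIdeal ^ 3)
    {c : ℚ⟮ζ⟯} (hc : c ≠ 0) :
    (3 : ℤ) ∣ FractionalIdeal.count N P (FractionalIdeal.spanSingleton (𝓞 N)⁰ (c : N)) := by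
  set f := algebraMap (𝓞 ℚ⟮ζ⟯) (𝓞 N) with hf
  obtain ⟨a, b, hb, hab⟩ := IsFractionRing.div_surjective (A := 𝓞 ℚ⟮ζ⟯) c
  have hb0 : b ≠ 0 := nonZeroDivisors.ne_zero hb
  have ha0 : a ≠ 0 := by
    rintro rfl
    rw [map_zero, zero_div] at hab
    exact hc hab.symm
  have hfa0 : f a ≠ 0 := (map_ne_zero_iff f (RingOfIntegers.algebraMap.injective ℚ⟮ζ⟯ N)).mpr ha0
  have hfb0 : f b ≠ 0 := (map_ne_zero_iff f (RingOfIntegers.algebraMap.injective ℚ⟮ζ⟯ N)).mpr hb0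
  -- `(c : N) = f a / f b`
  have hcoe : ∀ r : 𝓞 ℚ⟮ζ⟯, ((algebraMap (𝓞 ℚ⟮ζ⟯) ℚ⟮ζ⟯ r : ℚ⟮ζ⟯) : N) = ((f r : 𝓞 N) : N) :=
    fun r => rfl
  have hcN : (c : N) = ((f a : 𝓞 N) : N) * (((f b : 𝓞 N) : N))⁻¹ := by
    rw [← hcoe, ← hcoe, ← hab, ← div_eq_mul_inv]
    push_cast
    rfl
  have hfbN : ((f b : 𝓞 N) : N) ≠ 0 := by exact_mod_cast hfb0
  rw [hcN, ← FractionalIdeal.spanSingleton_mul_spanSingleton, ← FractionalIdeal.spanSingleton_inv,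
    FractionalIdeal.count_mul N P (FractionalIdeal.spanSingleton_ne_zero_iff.mpr (by exact_mod_cast hfa0))
      (inv_ne_zero (FractionalIdeal.spanSingleton_ne_zero_iff.mpr hfbN)),
    FractionalIdeal.count_inv, genus_count_spanSingleton_coe P hfa0,
    genus_count_spanSingleton_coe P hfb0]
  have hmap : ∀ r : 𝓞 ℚ⟮ζ⟯, Ideal.span {f r} = (Ideal.span {r}).map f := by
    intro r; rw [Ideal.map_span, Set.image_singleton]
  rw [hmap, hmap]
  have h1 := genus_three_dvd_multiplicity_map hζ hp P hspan
    (𝔞 := Ideal.span {a}) (by rwa [Ne, Ideal.span_singleton_eq_bot])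
  have h2 := genus_three_dvd_multiplicity_map hζ hp P hspan
    (𝔞 := Ideal.span {b}) (by rwa [Ne, Ideal.span_singleton_eq_bot])
  obtain ⟨k1, hk1⟩ := h1
  obtain ⟨k2, hk2⟩ := h2
  rw [hk1, hk2]
  push_cast
  exact ⟨k1 - k2, by ring⟩

omit [IsGalois ℚ N] in
/-- Two nonzero fractional ideals with the same counts everywhere are equal. [folklore] -/
theorem genus_eq_of_count_eq {I J : FractionalIdeal (𝓞 N)⁰ N} (hI : I ≠ 0) (hJ : J ≠ 0)
    (h : ∀ v : HeightOneSpectrum (𝓞 N), FractionalIdeal.count N v I = FractionalIdeal.count N v J) :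
    I = J := by
  rw [← FractionalIdeal.finprod_heightOneSpectrum_factorization' N hI,
    ← FractionalIdeal.finprod_heightOneSpectrum_factorization' N hJ]
  exact finprod_congr fun v => by rw [h v]

omit [IsGalois ℚ N] in
/-- A nonzero fractional ideal supported on `{P, Q}` is `P^a Q^b`. [folklore] -/
theorem genus_eq_zpow_mul_zpow {P Q : HeightOneSpectrum (𝓞 N)} (hPQ : P ≠ Q)
    {I : FractionalIdeal (𝓞 N)⁰ N} (hI : I ≠ 0)
    (h : ∀ v : HeightOneSpectrum (𝓞 N), v ≠ P → v ≠ Q → FractionalIdeal.count N v I = 0) :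
    I = (P.asIdeal : FractionalIdeal (𝓞 N)⁰ N) ^ FractionalIdeal.count N P I *
      (Q.asIdeal : FractionalIdeal (𝓞 N)⁰ N) ^ FractionalIdeal.count N Q I := by
  have hP0 : (P.asIdeal : FractionalIdeal (𝓞 N)⁰ N) ^ FractionalIdeal.count N P I ≠ 0 :=
    zpow_ne_zero _ (FractionalIdeal.coeIdeal_ne_zero.mpr P.ne_bot)
  have hQ0 : (Q.asIdeal : FractionalIdeal (𝓞 N)⁰ N) ^ FractionalIdeal.count N Q I ≠ 0 :=
    zpow_ne_zero _ (FractionalIdeal.coeIdeal_ne_zero.mpr Q.ne_bot)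
  refine genus_eq_of_count_eq hI (mul_ne_zero hP0 hQ0) fun v => ?_
  rw [FractionalIdeal.count_mul N v hP0 hQ0, FractionalIdeal.count_zpow, FractionalIdeal.count_zpow]
  by_cases hvP : v = P
  · rw [hvP, FractionalIdeal.count_self, FractionalIdeal.count_maximal_coprime N P hPQ.symm]; ring
  · by_cases hvQ : v = Q
    · rw [hvQ, FractionalIdeal.count_self, FractionalIdeal.count_maximal_coprime N Q hPQ]; ring
    · rw [h v hvP hvQ, FractionalIdeal.count_maximal_coprime N v (Ne.symm hvP),
        FractionalIdeal.count_maximal_coprime N v (Ne.symm hvQ)]; ring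

omit [IsGalois ℚ N] in
/-- `P³ = (p)` as fractional ideals. [folklore] -/
theorem genus_coe_zpow_three {p : ℕ} (P : HeightOneSpectrum (𝓞 N))
    (hspan : Ideal.span {(p : 𝓞 N)} = P.asIdeal ^ 3) :
    (P.asIdeal : FractionalIdeal (𝓞 N)⁰ N) ^ (3 : ℤ) = FractionalIdeal.spanSingleton (𝓞 N)⁰ (p : N) := by
  have h : ((Ideal.span {(p : 𝓞 N)} : Ideal (𝓞 N)) : FractionalIdeal (𝓞 N)⁰ N) =
      ((P.asIdeal ^ 3 : Ideal (𝓞 N)) : FractionalIdeal (𝓞 N)⁰ N) := by rw [hspan]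
  rw [FractionalIdeal.coeIdeal_span_singleton, FractionalIdeal.coeIdeal_pow] at h
  rw [zpow_ofNat, ← h]
  rfl

omit [IsGalois ℚ N] in
/-- The count of `(p)` at `P` is `3`, at other primes above... (only `P` needed): `v_P((p^k)) = 3k`.
[folklore] -/
theorem genus_count_natCast_zpow {p : ℕ} (P : HeightOneSpectrum (𝓞 N))
    (hspan : Ideal.span {(p : 𝓞 N)} = P.asIdeal ^ 3) (k : ℤ) :
    FractionalIdeal.spanSingleton (𝓞 N)⁰ ((p : N) ^ k) =
      (P.asIdeal : FractionalIdeal (𝓞 N)⁰ N) ^ (3 * k) := by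
  rw [zpow_mul, genus_coe_zpow_three P hspan]
  rcases k with k | k
  · rw [Int.ofNat_eq_natCast, zpow_natCast, zpow_natCast, FractionalIdeal.spanSingleton_pow]
  · rw [zpow_negSucc, zpow_negSucc, ← FractionalIdeal.spanSingleton_inv,
      FractionalIdeal.spanSingleton_pow]

/-- The restriction of `σ` to `𝓞 N`, read in `N`. [folklore] -/
theorem genus_coe_galRestrict (σ : N ≃ₐ[ℚ] N) (v : 𝓞 N) :
    ((galRestrict ℤ ℚ N (𝓞 N) σ v : 𝓞 N) : N) = σ (v : N) :=
  algebraMap_galRestrict_apply ℤ σ v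

omit [IsGalois ℚ N] in
/-- `(x)^k = (x^k)` for integer exponents. [folklore] -/
theorem genus_spanSingleton_zpow (x : N) (k : ℤ) :
    FractionalIdeal.spanSingleton (𝓞 N)⁰ x ^ k = FractionalIdeal.spanSingleton (𝓞 N)⁰ (x ^ k) := by
  rcases k with k | k
  · rw [Int.ofNat_eq_natCast, zpow_natCast, zpow_natCast, FractionalIdeal.spanSingleton_pow]
  · rw [zpow_negSucc, zpow_negSucc, ← FractionalIdeal.spanSingleton_inv,
      FractionalIdeal.spanSingleton_pow]

omit [IsGalois ℚ N] in
/-- An integral ideal whose fractional ideal is principal is principal. [folklore] -/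
theorem genus_isPrincipal_of_coe_eq {𝔞 : Ideal (𝓞 N)} {g : N}
    (h : (𝔞 : FractionalIdeal (𝓞 N)⁰ N) = FractionalIdeal.spanSingleton (𝓞 N)⁰ g) :
    Submodule.IsPrincipal 𝔞 := by
  have hg : g ∈ (𝔞 : FractionalIdeal (𝓞 N)⁰ N) := by
    rw [h]; exact FractionalIdeal.mem_spanSingleton_self _ g
  obtain ⟨g', hg', rfl⟩ := (FractionalIdeal.mem_coeIdeal _).mp hg
  have : Ideal.span {g'} = 𝔞 := by
    rw [← FractionalIdeal.coeIdeal_inj (K := N), FractionalIdeal.coeIdeal_span_singleton, h]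
  exact ⟨⟨g', by rw [← this]⟩⟩

/-! ### Powers of `σ` -/

omit [IsGalois ℚ N] in
/-- Elements of `⟨σ⟩` are natural powers of `σ` (the Galois group is finite). [folklore] -/
theorem genus_exists_pow_of_mem_zpowers {σ g : N ≃ₐ[ℚ] N}
    (hg : g ∈ Subgroup.zpowers σ) : ∃ k : ℕ, g = σ ^ k := by
  rw [← mem_powers_iff_mem_zpowers] at hg
  obtain ⟨k, hk⟩ := hg
  exact ⟨k, hk.symm⟩

/-- `(σ^k) x = u_k • x` if `σ x = u • x` with `u ∈ 𝓞 N`. [folklore] -/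
theorem genus_pow_apply_of_apply_eq_smul {σ : N ≃ₐ[ℚ] N} {x : N} {u : 𝓞 N}
    (hx : σ x = (u : N) * x) (k : ℕ) : ∃ v : 𝓞 N, (σ ^ k) x = (v : N) * x := by
  induction k with
  | zero => exact ⟨1, by simp⟩
  | succ k ih =>
    obtain ⟨v, hv⟩ := ih
    refine ⟨galRestrict ℤ ℚ N (𝓞 N) σ v * u, ?_⟩
    have h1 : σ ((v : 𝓞 N) : N) = ((galRestrict ℤ ℚ N (𝓞 N) σ v : 𝓞 N) : N) :=
      (genus_coe_galRestrict σ v).symm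
    rw [pow_succ', AlgEquiv.mul_apply, hv, map_mul σ, hx, h1]
    push_cast
    ring

/-- A principal fractional ideal `(x)` with `σ x ∈ 𝓞_N · x` is stable under `⟨σ⟩`. [folklore] -/
theorem genus_spanSingleton_stable {σ : N ≃ₐ[ℚ] N} {x : N} {u : 𝓞 N}
    (hx : σ x = (u : N) * x) {g : N ≃ₐ[ℚ] N} (hg : g ∈ Subgroup.zpowers σ) {y : N}
    (hy : y ∈ FractionalIdeal.spanSingleton (𝓞 N)⁰ x) :
    g y ∈ FractionalIdeal.spanSingleton (𝓞 N)⁰ x := by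
  obtain ⟨k, rfl⟩ := genus_exists_pow_of_mem_zpowers hg
  obtain ⟨v, hv⟩ := genus_pow_apply_of_apply_eq_smul hx k
  rw [FractionalIdeal.mem_spanSingleton] at hy ⊢
  obtain ⟨r, rfl⟩ := hy
  refine ⟨galRestrict ℤ ℚ N (𝓞 N) (σ ^ k) r * v, ?_⟩
  have h1 : (σ ^ k) (algebraMap (𝓞 N) N r) =
      algebraMap (𝓞 N) N (galRestrict ℤ ℚ N (𝓞 N) (σ ^ k) r) :=
    (algebraMap_galRestrict_apply ℤ (σ ^ k) r).symm
  rw [Algebra.smul_def, Algebra.smul_def, map_mul (σ ^ k), hv, map_mul (algebraMap (𝓞 N) N), h1]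
  ring

/-- An integral ideal `𝔟` with `σ̂(𝔟) ⊆ 𝔟` is stable under `⟨σ⟩` (as a fractional ideal). [folklore] -/
theorem genus_coeIdeal_stable {σ : N ≃ₐ[ℚ] N} {𝔟 : Ideal (𝓞 N)}
    (h𝔟 : ∀ y ∈ 𝔟, galRestrict ℤ ℚ N (𝓞 N) σ y ∈ 𝔟) {g : N ≃ₐ[ℚ] N}
    (hg : g ∈ Subgroup.zpowers σ) {y : N} (hy : y ∈ (𝔟 : FractionalIdeal (𝓞 N)⁰ N)) :
    g y ∈ (𝔟 : FractionalIdeal (𝓞 N)⁰ N) := by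
  obtain ⟨k, rfl⟩ := genus_exists_pow_of_mem_zpowers hg
  rw [FractionalIdeal.mem_coeIdeal] at hy ⊢
  obtain ⟨z, hz, rfl⟩ := hy
  refine ⟨galRestrict ℤ ℚ N (𝓞 N) (σ ^ k) z, ?_, ?_⟩
  · have : ∀ n : ℕ, ∀ w ∈ 𝔟, galRestrict ℤ ℚ N (𝓞 N) (σ ^ n) w ∈ 𝔟 := by
      intro n
      induction n with
      | zero => intro w hw; simpa using hw
      | succ n ih =>
        intro w hw
        rw [pow_succ', map_mul, AlgEquiv.mul_apply]
        exact h𝔟 _ (ih w hw)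
    exact this k z hz
  · exact algebraMap_galRestrict_apply ℤ (σ ^ k) z

end Ideals

/-! ### Summary (registered anchor of this helper file) -/

omit [IsGalois ℚ N] in
/-- **Elements of `ℚ(ζ)` have `P`-adic order `≡ 0 (mod 3)` when `(p) = P³`**, explicit form (the
registered anchor statement of this helper file). [folklore] -/
theorem genus_three_dvd_count_adjoin_explicit (N : Type) [Field N] [NumberField N] (ζ : N)
    (hζ : ζ ^ 2 + ζ + 1 = 0) (p : ℕ) (hp : p.Prime) (P : HeightOneSpectrum (𝓞 N))
    (hspan : Ideal.span {(p : 𝓞 N)} = P.asIdeal ^ 3) (c : ℚ⟮ζ⟯) (hc : c ≠ 0) :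
    (3 : ℤ) ∣ FractionalIdeal.count N P (FractionalIdeal.spanSingleton (𝓞 N)⁰ (c : N)) :=
  genus_three_dvd_count_adjoin (genus_isPrimitiveRoot hζ) hp P hspan hc

end Summit.QuantumAdvantage.QuantumAdvantage.Theorems.LinnikCubicClassGroups
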